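import Summits.QuantumFields.YangMills.Theorems.BalabanStepParabolic.Negative.OrbitTransport
import Summits.QuantumFields.YangMills.Theorems.BalabanStepParabolic.Negative.TorusRegularity
import HarnessLib

/-!
# `BalabanStepParabolic` — negative-side support: the over-tuned corner is forced to be trivial

Support file for crux `stmt-QuantumFields-9684` (`ParabolicTrajectory.BalabanStepParabolic`), line
`perfect-action-regulator-chart` (drefute gen 2). Theorems about an ARBITRARY inhabitant
`S : BalabanBanachStep G r M` at ODD `M`; tree objects only.

* `orbit_fibre_le`, `orbit_small`: for a Wilson coupling `g ≤ gT` (`gT = min (gₛ/2) g₀`, `gₛ` the threshold of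
  `OrbitTransport`) and every depth `k` with `4 c₁ k g² ≤ 1` (`c₁ = b + C(δ+R)`), the orbit point
  `F^[k] (g, yW g)` has coupling coordinate `≤ 2g` (in fact `x² ≤ 2g²`) and fibre norm `≤ θ′^k R + 2Cg²/(1−θ′)`.
* `tendsto_orbit_origin`: hence along ANY sequence `g_i → 0⁺`, `k_i → ∞` with `4 c₁ k_i g_i² ≤ 1` the orbit points
  converge to the corner fixed point `(0, 0)` of the chart — no continuity of `F` is used (the structure has none in
  `g` off the `δ`-ball), only contraction and the parabolic a-priori bounds.
* `expect_origin_eq_zero`: continuity (4c) at `(0,0)` + transport (4a)+(4b) + finite-torus regularity force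
  `expect (0,0) (2L+1) (n+1) curvatureⁿ⁺¹ f = 0` for off-diagonal `f`.
* `tendsto_wilson_overtuned` (chart form) and **`overtuned_trivial_of_nonempty`** (RG-free form): every inhabitant at
  odd `M` forces the genuine centred curvature `n`-point Wilson functions on the tori `M^{k_i}(2L+1)` with `k_i`-fold
  block-dilated off-diagonal test functions to tend to `0` along EVERY sequence `β_i ≥ β₀`, `k_i → ∞` with
  `k_i ≤ A β_i` — for some `A, β₀` depending on the inhabitant ("over-tuned triviality": fewer than `A β` block steps
  keeps every scale asymptotically free; physically the data are `O(β⁻²)`, so this is a near-miss, not a kill — but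
  it is one half of the identification of the crux's content at odd `M` with an RG-free statement, see the drefute
  note `Cruxes/BalabanStepParabolic/Negative-notes/stub_regulatorChart.md`).
-/

namespace Summit.QuantumFields.YangMills.Theorems.BalabanStepParabolic.Negative

open scoped SchwartzMap
open MeasureTheory Filter Topology
open Literature.MathematicalPhysics.QuantumFieldTheory Literature.MathematicalPhysics.AQFT
open Literature.MathematicalPhysics.QuantumLattice

noncomputable section

variable {G : Type} [Group G] [TopologicalSpace G] [IsTopologicalGroup G] [CompactSpace G]
  [MeasurableSpace G] [BorelSpace G] {r : LatticeRep G} {M : ℕ} (S : BalabanBanachStep G r M)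

/-! ### Thresholds (`gₛ`, `gT = min (gₛ/2) g₀`, inline) -/

-- Thresholds are written INLINE (no definitions in this support file): `gₛ = min δ (min √(1/(2c₁)) √((1−θ′)R/C))`
-- is the smallness threshold of `OrbitTransport`, and the over-tuning threshold is `gT = min (gₛ/2) g₀`.

/-- `gT > 0`. [folklore] -/
theorem gT_pos : 0 < (min ((min S.δ (min (Real.sqrt (1 / (2 * (S.b + S.C * (S.δ + S.R))))) (Real.sqrt ((1 - S.θ') * S.R / S.C)))) / 2) S.g₀) := lt_min (by have := gₛ_pos S; positivity) S.g₀_pos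

/-- `gT ≤ g₀`: over-tuned couplings are Wilson couplings. [folklore] -/
theorem gT_le_g₀ : (min ((min S.δ (min (Real.sqrt (1 / (2 * (S.b + S.C * (S.δ + S.R))))) (Real.sqrt ((1 - S.θ') * S.R / S.C)))) / 2) S.g₀) ≤ S.g₀ := min_le_right _ _

/-- `2 gT ≤ gₛ`. [folklore] -/
theorem two_mul_gT_le_gS : 2 * (min ((min S.δ (min (Real.sqrt (1 / (2 * (S.b + S.C * (S.δ + S.R))))) (Real.sqrt ((1 - S.θ') * S.R / S.C)))) / 2) S.g₀) ≤ (min S.δ (min (Real.sqrt (1 / (2 * (S.b + S.C * (S.δ + S.R))))) (Real.sqrt ((1 - S.θ') * S.R / S.C)))) := by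
  have : (min ((min S.δ (min (Real.sqrt (1 / (2 * (S.b + S.C * (S.δ + S.R))))) (Real.sqrt ((1 - S.θ') * S.R / S.C)))) / 2) S.g₀) ≤ (min S.δ (min (Real.sqrt (1 / (2 * (S.b + S.C * (S.δ + S.R))))) (Real.sqrt ((1 - S.θ') * S.R / S.C)))) / 2 := min_le_left _ _
  linarith

/-- `gT ≤ gₛ`. [folklore] -/
theorem gT_le_gS : (min ((min S.δ (min (Real.sqrt (1 / (2 * (S.b + S.C * (S.δ + S.R))))) (Real.sqrt ((1 - S.θ') * S.R / S.C)))) / 2) S.g₀) ≤ (min S.δ (min (Real.sqrt (1 / (2 * (S.b + S.C * (S.δ + S.R))))) (Real.sqrt ((1 - S.θ') * S.R / S.C)))) := by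
  have := two_mul_gT_le_gS S; have := gT_pos S; linarith

/-- `gT ≤ δ`. [folklore] -/
theorem gT_le_δ : (min ((min S.δ (min (Real.sqrt (1 / (2 * (S.b + S.C * (S.δ + S.R))))) (Real.sqrt ((1 - S.θ') * S.R / S.C)))) / 2) S.g₀) ≤ S.δ := (gT_le_gS S).trans (gₛ_le_δ S)

/-- From `g ≤ gT` and `4 c₁ k g² ≤ 1`, the orbit-length hypothesis of `orbit_mem_chart`. [folklore] -/
theorem depth_hyp {g : ℝ} (hg0 : 0 < g) (hgT : g ≤ (min ((min S.δ (min (Real.sqrt (1 / (2 * (S.b + S.C * (S.δ + S.R))))) (Real.sqrt ((1 - S.θ') * S.R / S.C)))) / 2) S.g₀)) {k : ℕ}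
    (hk : 4 * (S.b + S.C * (S.δ + S.R)) * k * g ^ 2 ≤ 1) :
    2 * (S.b + S.C * (S.δ + S.R)) * k ≤ 1 / g ^ 2 - 1 / ((min S.δ (min (Real.sqrt (1 / (2 * (S.b + S.C * (S.δ + S.R))))) (Real.sqrt ((1 - S.θ') * S.R / S.C))))) ^ 2 := by
  have hgS : 2 * g ≤ (min S.δ (min (Real.sqrt (1 / (2 * (S.b + S.C * (S.δ + S.R))))) (Real.sqrt ((1 - S.θ') * S.R / S.C)))) := by have := two_mul_gT_le_gS S; linarith
  have hg2 : 0 < g ^ 2 := by positivity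
  have h1 : 1 / ((min S.δ (min (Real.sqrt (1 / (2 * (S.b + S.C * (S.δ + S.R))))) (Real.sqrt ((1 - S.θ') * S.R / S.C))))) ^ 2 ≤ 1 / (2 * g) ^ 2 :=
    one_div_le_one_div_of_le (by positivity) (pow_le_pow_left₀ (by positivity) hgS 2)
  have h2 : 2 * (S.b + S.C * (S.δ + S.R)) * k ≤ 1 / (2 * g ^ 2) := by
    rw [le_div_iff₀ (by positivity)]; nlinarith
  have h3 : 1 / (2 * g ^ 2) + 1 / (2 * g) ^ 2 ≤ 1 / g ^ 2 := by
    rw [show (2 * g) ^ 2 = 4 * g ^ 2 by ring, div_add_div _ _ (by positivity) (by positivity),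
      div_le_div_iff₀ (by positivity) hg2]
    nlinarith
  linarith

/-! ### Orbit points of over-tuned depth are small -/

/-- **Fibre memory fades**: along the first `k` steps of a Wilson orbit whose coupling coordinate stays
`≤ δ` with `x_j² ≤ 2g²` and in the basin, `‖y_j‖ ≤ θ′^j R + 2 C g²/(1 − θ′)`. [folklore] -/
theorem orbit_fibre_le {g : ℝ} (hgW : ‖S.yW g‖ ≤ S.R) (k : ℕ)
    (h : ∀ j ≤ k, 0 < (S.F^[j] (g, S.yW g)).1 ∧ (S.F^[j] (g, S.yW g)).1 ≤ S.δ ∧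
      (S.F^[j] (g, S.yW g)).1 ^ 2 ≤ 2 * g ^ 2 ∧ ‖(S.F^[j] (g, S.yW g)).2‖ ≤ S.R) :
    ∀ j ≤ k, ‖(S.F^[j] (g, S.yW g)).2‖ ≤ S.θ' ^ j * S.R + 2 * S.C * g ^ 2 / (1 - S.θ') := by
  have hθ0 := S.θ'_nonneg
  have hθ1 : 0 < 1 - S.θ' := by linarith [S.θ'_lt_one]
  have hC := S.C_pos.le
  intro j hj
  induction j with
  | zero =>
    simp only [Function.iterate_zero, id_eq, pow_zero, one_mul]
    have : 0 ≤ 2 * S.C * g ^ 2 / (1 - S.θ') := by positivity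
    linarith
  | succ j ih =>
    have ih' := ih (Nat.le_of_succ_le hj)
    obtain ⟨hpos, hδ, hsq, hR⟩ := h j (Nat.le_of_succ_le hj)
    set q := S.F^[j] (g, S.yW g) with hq
    have hstep : S.F^[j + 1] (g, S.yW g) = (S.φ q.1 q.2, S.Ψ q.1 q.2) := by
      rw [Function.iterate_succ_apply', hq]; rfl
    rw [hstep]
    have habs : |q.1| ≤ S.δ := by rwa [abs_of_pos hpos]
    have hΨ := S.norm_Ψ_le habs hR
    calc ‖S.Ψ q.1 q.2‖ ≤ S.θ' * ‖q.2‖ + S.C * q.1 ^ 2 := hΨ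
      _ ≤ S.θ' * (S.θ' ^ j * S.R + 2 * S.C * g ^ 2 / (1 - S.θ')) + S.C * (2 * g ^ 2) := by
          gcongr
      _ = S.θ' ^ (j + 1) * S.R + 2 * S.C * g ^ 2 / (1 - S.θ') := by
          field_simp
          ring

/-- **Over-tuned orbit points are small.** For `0 < g ≤ gT` and `4 c₁ k g² ≤ 1`: every orbit point
`F^[j](g, yW g)`, `j ≤ k`, lies in the chart with coupling coordinate `x_j > 0`, `x_j² ≤ 2 g²`, and fibre norm
`≤ θ′^j R + 2Cg²/(1−θ′)`. [folklore] -/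
theorem orbit_small {g : ℝ} (hg0 : 0 < g) (hgT : g ≤ (min ((min S.δ (min (Real.sqrt (1 / (2 * (S.b + S.C * (S.δ + S.R))))) (Real.sqrt ((1 - S.θ') * S.R / S.C)))) / 2) S.g₀)) (k : ℕ)
    (hk : 4 * (S.b + S.C * (S.δ + S.R)) * k * g ^ 2 ≤ 1) :
    ∀ j ≤ k, 0 < (S.F^[j] (g, S.yW g)).1 ∧ (S.F^[j] (g, S.yW g)).1 ≤ S.δ ∧
      (S.F^[j] (g, S.yW g)).1 ^ 2 ≤ 2 * g ^ 2 ∧ ‖(S.F^[j] (g, S.yW g)).2‖ ≤ S.R ∧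
      ‖(S.F^[j] (g, S.yW g)).2‖ ≤ S.θ' ^ j * S.R + 2 * S.C * g ^ 2 / (1 - S.θ') := by
  have hdep := depth_hyp S hg0 hgT hk
  have hgS : g ≤ (min S.δ (min (Real.sqrt (1 / (2 * (S.b + S.C * (S.δ + S.R))))) (Real.sqrt ((1 - S.θ') * S.R / S.C)))) := hgT.trans (gT_le_gS S)
  have hg₀ : g ≤ S.g₀ := hgT.trans (gT_le_g₀ S)
  have hmc := orbit_mem_chart S hg0 hgS hg₀ k hdep
  have hc₁ := c₁_pos S
  have hg2 : 0 < g ^ 2 := by positivity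
  have base : ∀ j ≤ k, 0 < (S.F^[j] (g, S.yW g)).1 ∧ (S.F^[j] (g, S.yW g)).1 ≤ S.δ ∧
      (S.F^[j] (g, S.yW g)).1 ^ 2 ≤ 2 * g ^ 2 ∧ ‖(S.F^[j] (g, S.yW g)).2‖ ≤ S.R := by
    intro j hj
    obtain ⟨hpos, hle, hy, hinv⟩ := hmc j hj
    refine ⟨hpos, hle.trans (gₛ_le_δ S), ?_, hy⟩
    -- 1/g² − 2c₁ j ≥ 1/(2g²)
    have hj' : (2 * (S.b + S.C * (S.δ + S.R)) * j : ℝ) ≤ 1 / (2 * g ^ 2) := by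
      have : (2 * (S.b + S.C * (S.δ + S.R)) * j : ℝ) ≤ 2 * (S.b + S.C * (S.δ + S.R)) * k := by
        have : (j : ℝ) ≤ k := by exact_mod_cast hj
        gcongr
      refine this.trans ?_
      rw [le_div_iff₀ (by positivity)]; nlinarith
    have hlow : 1 / (2 * g ^ 2) ≤ 1 / (S.F^[j] (g, S.yW g)).1 ^ 2 := by
      have e : 1 / g ^ 2 - 1 / (2 * g ^ 2) = 1 / (2 * g ^ 2) := by field_simp; ring
      linarith
    have hx2 : 0 < (S.F^[j] (g, S.yW g)).1 ^ 2 := by positivity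
    rw [div_le_div_iff₀ (by positivity) hx2, one_mul, one_mul] at hlow
    exact hlow
  intro j hj
  obtain ⟨h1, h2, h3, h4⟩ := base j hj
  exact ⟨h1, h2, h3, h4, orbit_fibre_le S (S.norm_yW_le g ⟨hg0.le, hg₀⟩) k base j hj⟩

/-- **Over-tuned Wilson orbits run into the corner.** Along any sequences `g_i → 0⁺` (`0 < g_i ≤ gT`),
`k_i → ∞` with `4 c₁ k_i g_i² ≤ 1`, the orbit points `F^[k_i] (g_i, yW g_i)` converge to `(0, 0)`. [folklore] -/
theorem tendsto_orbit_origin {g : ℕ → ℝ} {k : ℕ → ℕ} (hg0 : ∀ i, 0 < g i) (hgT : ∀ i, g i ≤ (min ((min S.δ (min (Real.sqrt (1 / (2 * (S.b + S.C * (S.δ + S.R))))) (Real.sqrt ((1 - S.θ') * S.R / S.C)))) / 2) S.g₀))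
    (hg : Tendsto g atTop (𝓝 0)) (hk : Tendsto k atTop atTop)
    (hdepth : ∀ i, 4 * (S.b + S.C * (S.δ + S.R)) * (k i) * (g i) ^ 2 ≤ 1) :
    Tendsto (fun i => S.F^[k i] (g i, S.yW (g i))) atTop (𝓝 ((0 : ℝ), (0 : S.E))) := by
  have hfacts := fun i => orbit_small S (hg0 i) (hgT i) (k i) (hdepth i) (k i) le_rfl
  -- first coordinate
  have h1 : Tendsto (fun i => (S.F^[k i] (g i, S.yW (g i))).1) atTop (𝓝 0) := by
    have hup : ∀ i, (S.F^[k i] (g i, S.yW (g i))).1 ≤ 2 * g i := fun i => by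
      obtain ⟨hpos, -, hsq, -⟩ := hfacts i
      have h4 : (S.F^[k i] (g i, S.yW (g i))).1 ^ 2 ≤ (2 * g i) ^ 2 := by
        nlinarith [sq_nonneg (g i)]
      exact (pow_le_pow_iff_left₀ hpos.le (by have := hg0 i; positivity) two_ne_zero).1 h4
    have h2g : Tendsto (fun i => 2 * g i) atTop (𝓝 0) := by simpa using hg.const_mul 2
    exact squeeze_zero (fun i => (hfacts i).1.le) hup h2g
  -- second coordinate
  have h2 : Tendsto (fun i => (S.F^[k i] (g i, S.yW (g i))).2) atTop (𝓝 0) := by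
    have hθ := tendsto_pow_atTop_nhds_zero_of_lt_one S.θ'_nonneg S.θ'_lt_one
    have hθk : Tendsto (fun i => S.θ' ^ (k i) * S.R) atTop (𝓝 0) := by
      simpa using (hθ.comp hk).mul_const S.R
    have hgsq : Tendsto (fun i => 2 * S.C * g i ^ 2 / (1 - S.θ')) atTop (𝓝 0) := by
      have := ((hg.pow 2).const_mul (2 * S.C)).div_const (1 - S.θ')
      simpa using this
    have hsum := hθk.add hgsq
    rw [add_zero] at hsum
    exact squeeze_zero_norm (fun i => (hfacts i).2.2.2.2) hsum
  have := h1.prodMk_nhds h2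
  simpa using this

/-! ### The corner value is zero -/

/-- The corner `(0,0)` is a chart point. [folklore] -/
theorem origin_mem_chart : ((0 : ℝ), (0 : S.E)) ∈ Set.Icc 0 S.δ ×ˢ Metric.closedBall (0 : S.E) S.R :=
  Set.mk_mem_prod ⟨le_rfl, S.δ_pos.le⟩ (by simp [S.R_pos.le])

/-- The genuine centred curvature `(n+1)`-point function on a fixed odd torus tends to `0` as `β → ∞`
(from `abs_curvCorr_le` and Laplace concentration `⟨S_W⟩_β → 0`; RG-free). [folklore] -/
theorem tendsto_curvature_wilson_zero (L n : ℕ) (f : Fin (n + 1) → 𝓢(EuclideanSpace ℝ (Fin 4), ℝ)) :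
    Tendsto (fun β => wilsonCentredSchwinger r.ρ β L (fun _ => 1) (n + 1) (fun _ => r.curvature) f)
      atTop (𝓝 0) := by
  obtain ⟨Kc, hKc⟩ := abs_curvCorr_le r L n f
  have h := (tendsto_expect_wilsonAction r (2 * L + 1)).const_mul Kc
  rw [mul_zero] at h
  exact squeeze_zero_norm (fun β => by rw [Real.norm_eq_abs]; exact hKc β) h

/-- Pure-curvature strings see the normalisations `S.c g` as `1`. [folklore] -/
theorem wilson_c_eq_one (g β : ℝ) (L n : ℕ) (f : Fin n → 𝓢(EuclideanSpace ℝ (Fin 4), ℝ)) :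
    wilsonCentredSchwinger r.ρ β L (S.c g) n (fun _ => r.curvature) f =
      wilsonCentredSchwinger r.ρ β L (fun _ => 1) n (fun _ => r.curvature) f :=
  wilsonCentredSchwinger_congr_c r.ρ β L (fun _ => S.c_curvature g) f

/-- For every depth `k` there is an over-tuned Wilson coupling `g ≤ min gT (1/(k+1))` with
`4c₁ k g² ≤ 1` whose transported curvature data at depth `k` is already `≤ 1/(k+1)` in size. [folklore] -/
theorem exists_overtuned_coupling (L n : ℕ) (f : Fin (n + 1) → 𝓢(EuclideanSpace ℝ (Fin 4), ℝ)) (k : ℕ) :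
    ∃ g : ℝ, 0 < g ∧ g ≤ (min ((min S.δ (min (Real.sqrt (1 / (2 * (S.b + S.C * (S.δ + S.R))))) (Real.sqrt ((1 - S.θ') * S.R / S.C)))) / 2) S.g₀) ∧ g ≤ 1 / (k + 1) ∧ 4 * (S.b + S.C * (S.δ + S.R)) * k * g ^ 2 ≤ 1 ∧
      |wilsonCentredSchwinger r.ρ (S.betaOf g) ((M ^ k * (2 * L + 1) - 1) / 2) (fun _ => 1) (n + 1)
        (fun _ => r.curvature) (fun j => (blockDilate M)^[k] (f j))| ≤ 1 / (k + 1) := by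
  set W : ℝ → ℝ := fun β => wilsonCentredSchwinger r.ρ β ((M ^ k * (2 * L + 1) - 1) / 2) (fun _ => 1)
    (n + 1) (fun _ => r.curvature) (fun j => (blockDilate M)^[k] (f j)) with hW
  have hT : Tendsto W atTop (𝓝 0) := tendsto_curvature_wilson_zero _ n _
  have hk1 : (0 : ℝ) < 1 / (k + 1) := by positivity
  have hev : ∀ᶠ β in atTop, dist (W β) 0 < 1 / (k + 1) := Metric.tendsto_nhds.1 hT _ hk1
  obtain ⟨B, hB⟩ := eventually_atTop.1 hev
  have hc₁ := c₁_pos S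
  set ε : ℝ := min ((min ((min S.δ (min (Real.sqrt (1 / (2 * (S.b + S.C * (S.δ + S.R))))) (Real.sqrt ((1 - S.θ') * S.R / S.C)))) / 2) S.g₀)) (min (1 / (k + 1)) (1 / (4 * (S.b + S.C * (S.δ + S.R)) * k + 1))) with hε
  have hεpos : 0 < ε := lt_min (gT_pos S) (lt_min hk1 (by positivity))
  have hev1 : ∀ᶠ g in 𝓝[>] (0 : ℝ), B ≤ S.betaOf g := S.tendsto_betaOf.eventually (eventually_ge_atTop B)
  have hev2 : ∀ᶠ g in 𝓝[>] (0 : ℝ), g ∈ Set.Ioo 0 ε := Ioo_mem_nhdsGT hεpos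
  obtain ⟨g, hgB, hg⟩ := (hev1.and hev2).exists
  have hgT : g ≤ (min ((min S.δ (min (Real.sqrt (1 / (2 * (S.b + S.C * (S.δ + S.R))))) (Real.sqrt ((1 - S.θ') * S.R / S.C)))) / 2) S.g₀) := hg.2.le.trans (min_le_left _ _)
  have hgk : g ≤ 1 / (k + 1) := hg.2.le.trans ((min_le_right _ _).trans (min_le_left _ _))
  have hgd : g ≤ 1 / (4 * (S.b + S.C * (S.δ + S.R)) * k + 1) :=
    hg.2.le.trans ((min_le_right _ _).trans (min_le_right _ _))
  refine ⟨g, hg.1, hgT, hgk, ?_, ?_⟩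
  · have hg1 : g ≤ 1 := hgk.trans (by rw [div_le_one (by positivity)]; linarith)
    have hgsq : g ^ 2 ≤ g := by nlinarith [hg.1]
    have hpos : 0 < 4 * (S.b + S.C * (S.δ + S.R)) * k + 1 := by positivity
    have h1 : g ^ 2 ≤ 1 / (4 * (S.b + S.C * (S.δ + S.R)) * k + 1) := hgsq.trans hgd
    rw [le_div_iff₀ hpos] at h1
    nlinarith [sq_nonneg g]
  · have h := hB (S.betaOf g) hgB
    rw [Real.dist_eq, sub_zero] at h
    exact h.le

/-- **The corner value is zero.** For every inhabitant at odd `M`, every odd base torus `2L+1` and every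
off-diagonal curvature tuple, `expect (0,0) (2L+1) (n+1) curvatureⁿ⁺¹ f = 0`: the over-tuned orbit points of
`exists_overtuned_coupling` tend to `(0,0)` carrying genuine Wilson data of size `≤ 1/(k+1)`, and (4c) is
continuity at `(0,0)`. [folklore] -/
theorem expect_origin_eq_zero (hM : Odd M) (L n : ℕ) (f : Fin (n + 1) → 𝓢(EuclideanSpace ℝ (Fin 4), ℝ))
    (hf : IsOffDiagonal (SchwartzMap.tensorFin (n + 1) fun i => ofRealTest (f i))) :
    S.expect (0, 0) (2 * L + 1) (n + 1) (fun _ => r.curvature) f = 0 := by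
  choose g hg0 hgT hgk hdep hsmall using exists_overtuned_coupling S L n f
  -- the orbit points and their convergence to the corner
  have hgt : Tendsto g atTop (𝓝 0) := by
    refine squeeze_zero (fun k => (hg0 k).le) hgk ?_
    exact tendsto_one_div_add_atTop_nhds_zero_nat
  have hconv := tendsto_orbit_origin S hg0 hgT hgt tendsto_id hdep
  -- the orbit points are in the chart and carry Wilson data
  have hdata : ∀ k, S.F^[k] (g k, S.yW (g k)) ∈ Set.Icc 0 S.δ ×ˢ Metric.closedBall (0 : S.E) S.R ∧
      S.expect (S.F^[k] (g k, S.yW (g k))) (2 * L + 1) (n + 1) (fun _ => r.curvature) f =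
        wilsonCentredSchwinger r.ρ (S.betaOf (g k)) ((M ^ k * (2 * L + 1) - 1) / 2) (fun _ => 1) (n + 1)
          (fun _ => r.curvature) (fun j => (blockDilate M)^[k] (f j)) := fun k => by
    have h := wilson_data_in_chart S hM (hg0 k) ((hgT k).trans (gT_le_gS S)) ((hgT k).trans (gT_le_g₀ S))
      k (depth_hyp S (hg0 k) (hgT k) (hdep k)) L (n + 1) (fun _ => r.curvature) f
    exact ⟨h.1, h.2.trans (wilson_c_eq_one S _ _ _ _ _)⟩
  -- the transported values tend to 0
  have hval : Tendsto (fun k => S.expect (S.F^[k] (g k, S.yW (g k))) (2 * L + 1) (n + 1)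
      (fun _ => r.curvature) f) atTop (𝓝 0) := by
    refine squeeze_zero_norm (fun k => ?_) tendsto_one_div_add_atTop_nhds_zero_nat
    rw [Real.norm_eq_abs, (hdata k).2]
    exact hsmall k
  -- continuity at the corner
  have hcont := (S.continuousOn_expect (2 * L + 1) (n + 1) (fun _ => r.curvature) f hf) _ (origin_mem_chart S)
  have h1 : Tendsto (fun k => S.F^[k] (g k, S.yW (g k))) atTop
      (𝓝[Set.Icc 0 S.δ ×ˢ Metric.closedBall (0 : S.E) S.R] ((0 : ℝ), (0 : S.E))) :=
    tendsto_nhdsWithin_iff.2 ⟨hconv, Eventually.of_forall fun k => (hdata k).1⟩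
  have h2 := hcont.tendsto.comp h1
  exact tendsto_nhds_unique h2 hval

/-! ### Over-tuned triviality is forced -/

/-- **Over-tuned data tend to zero (chart form).** For every inhabitant at odd `M` and all sequences
`0 < g_i ≤ gT`, `g_i → 0`, `k_i → ∞` with `4 c₁ k_i g_i² ≤ 1`, the genuine centred curvature `(n+1)`-point Wilson
functions at `β = betaOf g_i` on the tori `M^{k_i}(2L+1)` with `k_i`-fold dilated off-diagonal test functions tend
to `0`. [folklore] -/
theorem tendsto_wilson_overtuned (hM : Odd M) {g : ℕ → ℝ} {k : ℕ → ℕ} (hg0 : ∀ i, 0 < g i)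
    (hgT : ∀ i, g i ≤ (min ((min S.δ (min (Real.sqrt (1 / (2 * (S.b + S.C * (S.δ + S.R))))) (Real.sqrt ((1 - S.θ') * S.R / S.C)))) / 2) S.g₀)) (hg : Tendsto g atTop (𝓝 0)) (hk : Tendsto k atTop atTop)
    (hdepth : ∀ i, 4 * (S.b + S.C * (S.δ + S.R)) * (k i) * (g i) ^ 2 ≤ 1)
    (L n : ℕ) (f : Fin (n + 1) → 𝓢(EuclideanSpace ℝ (Fin 4), ℝ))
    (hf : IsOffDiagonal (SchwartzMap.tensorFin (n + 1) fun i => ofRealTest (f i))) :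
    Tendsto (fun i => wilsonCentredSchwinger r.ρ (S.betaOf (g i)) ((M ^ (k i) * (2 * L + 1) - 1) / 2)
        (fun _ => 1) (n + 1) (fun _ => r.curvature) (fun j => (blockDilate M)^[k i] (f j))) atTop (𝓝 0) := by
  have hk' : ∀ i, ∀ j ≤ k i, (S.F^[j] (g i, S.yW (g i))).1 ∈ Set.Icc 0 S.δ ∧
      ‖(S.F^[j] (g i, S.yW (g i))).2‖ ≤ S.R := fun i =>
    orbit_hyp S (hg0 i) ((hgT i).trans (gT_le_gS S)) ((hgT i).trans (gT_le_g₀ S)) (k i)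
      (depth_hyp S (hg0 i) (hgT i) (hdepth i))
  have h := tendsto_wilson_of_tendsto_orbit S hM (fun i => ⟨hg0 i, (hgT i).trans (gT_le_g₀ S)⟩) hk'
    (origin_mem_chart S) (tendsto_orbit_origin S hg0 hgT hg hk hdepth) L (n + 1) (fun _ => r.curvature) f hf
  rw [expect_origin_eq_zero S hM L n f hf] at h
  refine h.congr fun i => ?_
  exact wilson_c_eq_one S _ _ _ _ _

/-- Inverting the bare-coupling dictionary on `(0, gT]`: every `β ≥ betaOf gT` is `betaOf g` for some
`g ∈ (0, gT]` (IVT + `betaOf → ∞`). [folklore] -/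
theorem exists_betaOf_eq {β : ℝ} (hβ : S.betaOf ((min ((min S.δ (min (Real.sqrt (1 / (2 * (S.b + S.C * (S.δ + S.R))))) (Real.sqrt ((1 - S.θ') * S.R / S.C)))) / 2) S.g₀)) ≤ β) : ∃ g : ℝ, 0 < g ∧ g ≤ (min ((min S.δ (min (Real.sqrt (1 / (2 * (S.b + S.C * (S.δ + S.R))))) (Real.sqrt ((1 - S.θ') * S.R / S.C)))) / 2) S.g₀) ∧ S.betaOf g = β := by
  have hev1 : ∀ᶠ g in 𝓝[>] (0 : ℝ), β ≤ S.betaOf g := S.tendsto_betaOf.eventually (eventually_ge_atTop β)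
  have hev2 : ∀ᶠ g in 𝓝[>] (0 : ℝ), g ∈ Set.Ioo 0 ((min ((min S.δ (min (Real.sqrt (1 / (2 * (S.b + S.C * (S.δ + S.R))))) (Real.sqrt ((1 - S.θ') * S.R / S.C)))) / 2) S.g₀)) := Ioo_mem_nhdsGT (gT_pos S)
  obtain ⟨g₁, hg₁β, hg₁⟩ := (hev1.and hev2).exists
  have hcont : ContinuousOn S.betaOf (Set.Icc g₁ ((min ((min S.δ (min (Real.sqrt (1 / (2 * (S.b + S.C * (S.δ + S.R))))) (Real.sqrt ((1 - S.θ') * S.R / S.C)))) / 2) S.g₀))) :=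
    S.continuousOn_betaOf.mono fun x hx => ⟨hg₁.1.trans_le hx.1, hx.2.trans (gT_le_g₀ S)⟩
  obtain ⟨g, hg, hgβ⟩ := intermediate_value_Icc' hg₁.2.le hcont ⟨hβ, hg₁β⟩
  exact ⟨g, hg₁.1.trans_le hg.1, hg.2, hgβ⟩

/-- The dictionary bound read backwards: `g² ≤ κ/(betaOf g − K)` whenever `betaOf g > K`. [folklore] -/
theorem sq_le_of_betaOf {g : ℝ} (hg0 : 0 < g) (hg₀ : g ≤ S.g₀) (hK : S.K < S.betaOf g) :
    g ^ 2 ≤ S.κ / (S.betaOf g - S.K) := by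
  have h := (abs_le.1 (S.betaOf_sub_le g ⟨hg0, hg₀⟩)).2
  have hg2 : 0 < g ^ 2 := by positivity
  rw [le_div_iff₀ (by linarith)]
  have : S.betaOf g - S.K ≤ S.κ / g ^ 2 := by linarith
  calc g ^ 2 * (S.betaOf g - S.K) ≤ g ^ 2 * (S.κ / g ^ 2) := by gcongr
    _ = S.κ := by field_simp

/-- **Over-tuned triviality is forced (RG-free form).** Every inhabitant of `BalabanBanachStep G r M` at
odd `M` yields constants `β₀` and `A > 0` such that along EVERY sequence of inverse couplings `β_i ≥ β₀` and depths
`k_i → ∞` with `k_i ≤ A β_i`, the genuine centred curvature `(n+1)`-point functions of Wilson's lattice theory on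
the tori of side `M^{k_i}(2L+1)`, smeared with `k_i`-fold block-dilated off-diagonal test functions (unit
normalisation, exact centring), tend to `0`. Physically `A` below the asymptotic-freedom slope keeps every
scale weakly coupled and the data are `O(β⁻²)` — a near-miss; but the statement involves no chart, no
step and no `b₀`. [folklore] -/
theorem overtuned_trivial_of_nonempty (hM : Odd M) (hS : Nonempty (BalabanBanachStep G r M)) :
    ∃ β₀ A : ℝ, 0 < A ∧ ∀ (β : ℕ → ℝ) (k : ℕ → ℕ), (∀ i, β₀ ≤ β i) → Tendsto k atTop atTop →
      (∀ i, (k i : ℝ) ≤ A * β i) →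
      ∀ (L n : ℕ) (f : Fin (n + 1) → 𝓢(EuclideanSpace ℝ (Fin 4), ℝ)),
        IsOffDiagonal (SchwartzMap.tensorFin (n + 1) fun i => ofRealTest (f i)) →
        Tendsto (fun i => wilsonCentredSchwinger r.ρ (β i) ((M ^ (k i) * (2 * L + 1) - 1) / 2)
          (fun _ => 1) (n + 1) (fun _ => r.curvature) (fun j => (blockDilate M)^[k i] (f j))) atTop (𝓝 0) := by
  obtain ⟨S⟩ := hS
  have hc₁ := c₁_pos S
  have hκ := S.κ_pos
  set c₁ := S.b + S.C * (S.δ + S.R) with hc₁def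
  refine ⟨max (S.betaOf ((min ((min S.δ (min (Real.sqrt (1 / (2 * (S.b + S.C * (S.δ + S.R))))) (Real.sqrt ((1 - S.θ') * S.R / S.C)))) / 2) S.g₀))) (2 * |S.K| + 1), 1 / (8 * c₁ * S.κ), by positivity, ?_⟩
  intro β k hβ hk hkA L n f hf
  -- choose chart couplings with betaOf (g i) = β i
  have hβ' : ∀ i, S.betaOf ((min ((min S.δ (min (Real.sqrt (1 / (2 * (S.b + S.C * (S.δ + S.R))))) (Real.sqrt ((1 - S.θ') * S.R / S.C)))) / 2) S.g₀)) ≤ β i := fun i => (le_max_left _ _).trans (hβ i)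
  choose g hg0 hgT hgβ using fun i => exists_betaOf_eq S (hβ' i)
  have hβK : ∀ i, 2 * |S.K| + 1 ≤ β i := fun i => (le_max_right _ _).trans (hβ i)
  have hKlt : ∀ i, S.K < S.betaOf (g i) := fun i => by
    rw [hgβ i]; linarith [le_abs_self S.K, abs_nonneg S.K, hβK i]
  have hden : ∀ i, |S.K| + 1 ≤ β i - S.K := fun i => by linarith [le_abs_self S.K, hβK i]
  have hsq : ∀ i, (g i) ^ 2 ≤ S.κ / (β i - S.K) := fun i => by
    have h := sq_le_of_betaOf S (hg0 i) ((hgT i).trans (gT_le_g₀ S)) (hKlt i)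
    rwa [hgβ i] at h
  -- depth condition 4 c₁ k g² ≤ 1
  have hdepth : ∀ i, 4 * c₁ * (k i) * (g i) ^ 2 ≤ 1 := fun i => by
    have hd : 0 < β i - S.K := by linarith [abs_nonneg S.K, hden i]
    have hnn : (0 : ℝ) ≤ S.κ / (β i - S.K) := div_nonneg hκ.le hd.le
    have h1 : 4 * c₁ * (k i) * (g i) ^ 2 ≤ 4 * c₁ * (1 / (8 * c₁ * S.κ) * β i) * (S.κ / (β i - S.K)) := by
      have h4 : (0 : ℝ) ≤ 4 * c₁ * (k i) := by positivity
      calc 4 * c₁ * (k i) * (g i) ^ 2 ≤ 4 * c₁ * (k i) * (S.κ / (β i - S.K)) :=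
            mul_le_mul_of_nonneg_left (hsq i) h4
        _ ≤ 4 * c₁ * (1 / (8 * c₁ * S.κ) * β i) * (S.κ / (β i - S.K)) := by
            apply mul_le_mul_of_nonneg_right _ hnn
            exact mul_le_mul_of_nonneg_left (hkA i) (by positivity)
    refine h1.trans ?_
    have e : 4 * c₁ * (1 / (8 * c₁ * S.κ) * β i) * (S.κ / (β i - S.K)) = β i / (2 * (β i - S.K)) := by
      field_simp
      ring
    rw [e, div_le_one (by positivity)]
    linarith [le_abs_self S.K, hβK i]
  -- β i → ∞, hence g i → 0
  have hβtop : Tendsto β atTop atTop := by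
    have hkR : Tendsto (fun i => (k i : ℝ)) atTop atTop := tendsto_natCast_atTop_atTop.comp hk
    have hA : 0 < 1 / (8 * c₁ * S.κ) := by positivity
    have h1 : Tendsto (fun i => (8 * c₁ * S.κ) * (k i : ℝ)) atTop atTop := hkR.const_mul_atTop (by positivity)
    refine tendsto_atTop_mono (fun i => ?_) h1
    have h8 : (0 : ℝ) < 8 * c₁ * S.κ := by positivity
    exact (le_inv_mul_iff₀ h8).1 (by simpa only [one_div] using hkA i)
  have hgt : Tendsto g atTop (𝓝 0) := by
    have hquot : Tendsto (fun i => S.κ / (β i - S.K)) atTop (𝓝 0) :=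
      tendsto_const_nhds.div_atTop (tendsto_atTop_add_const_right _ (-S.K) hβtop)
    rw [Metric.tendsto_nhds]
    intro ε hε
    have hev : ∀ᶠ i in atTop, S.κ / (β i - S.K) < ε ^ 2 :=
      (tendsto_order.1 hquot).2 _ (by positivity)
    filter_upwards [hev] with i hi
    rw [Real.dist_eq, sub_zero]
    have h2 : (g i) ^ 2 < ε ^ 2 := (hsq i).trans_lt hi
    exact abs_lt_of_sq_lt_sq h2 hε.le
  have h := tendsto_wilson_overtuned S hM hg0 hgT hgt hk hdepth L n f hf
  refine h.congr fun i => ?_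
  rw [hgβ i]

end

end Summit.QuantumFields.YangMills.Theorems.BalabanStepParabolic.Negative
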